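import Summits.BirchSwinnertonDyer.BirchSwinnertonDyer.Theorems.ByReductionTypeAtTwoAnalyticMuZero
import Summits.BirchSwinnertonDyer.Rank1Residual.X5.TwoAdicTargets
import Literature.NumberTheory.EllipticCurves.NonEisensteinPrimeOfSurjective
import HarnessLib

/-!
# Route `ByReductionTypeAtTwo` (K4), crux 19573 `OrdKatoHalfAtTwoIso`, line `steinberg_fibre_at_two` — SOCKET 3
# «analytic `μ₂ = 0` on the Gaussian residue» in its VERBATIM shape, as a kernel theorem (consumer spellings of
# `ByReductionTypeAtTwoAnalyticMuZero` for the K4 line seats)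

Cell `bsd-2adic`, seat `bsd-2adic-tower-1` (GEN 24), `--supports stmt-BirchSwinnertonDyer-19271` (helper; planner
RC-254 «consumers import P5 BY NAME: 19573 L1 socket 3 (`socket3_of`) …»).  Theorems only; no definition, no named
fact, no `sorry`.

The line `Cruxes/OrdKatoHalfAtTwoIso/Lines/steinberg_fibre_at_two.lean` (cruxidea-19573-2) displays as its open
∀-heart SOCKET 3 `AnalyticMuZeroFOnDD12Residue`:
`∀ W, ¬ W.HasCM → GoodOrd W 2 → W.HasSurjectiveModNGaloisRep 2 → ¬ O1.TwoAdicSurjective W → ∀ f, IsNewformOf W f →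
∃ n, ‖coeff n (padicLFunction f (unitRoot W 2))‖ = 1`.  Its body is an instance of this seat's theorem
`AnalyticMuTwo.exists_norm_padicLCoeff_two_eq_one` (good ordinary at `2` + `E[2]` irreducible; a surjective mod-`2`
representation is irreducible, `hasIrreducibleModPGaloisRep_of_hasSurjectiveModNGaloisRep`); the hypotheses `¬CM` and
`¬ TwoAdicSurjective` are idle.  A Theorems file may not import the (sorry-bearing) line file, so the discharge is
recorded here in the socket's LITERAL shape (`analyticMuZeroFOnDD12Residue_shape`): the future LEAD of the line closes
socket 3 by `exact AnalyticMuTwo.analyticMuZeroFOnDD12Residue_shape` (the two `Prop`s agree by `Iff.rfl`).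

* `exists_norm_coeff_padicLFunction_two_eq_one_of_surj` — per curve: `GoodOrd W 2 → W.HasSurjectiveModNGaloisRep 2 →
  IsNewformOf W f → ∃ n, ‖coeff n (L₂(f, α, T))‖ = 1`;
* `analyticMuZeroFOnDD12Residue_shape` — the ∀-statement in socket 3's binder order.

HONEST FRAMING: see `ByReductionTypeAtTwoAnalyticMuZero`; closes nothing by itself (the line's other sockets are its
business); BSD is not proved by any of this.

References: [GreenbergLNM1716] §1 Conj. 1.11; [MazurTateTeitelbaum1986Invent] §I.10–I.13; [SerreOpenImage1972] §4.
-/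

-- the summit namespace repeats `BirchSwinnertonDyer` by design (summit = problem); linter moot
set_option linter.dupNamespace false
set_option autoImplicit false

noncomputable section

namespace Summit.BirchSwinnertonDyer.BirchSwinnertonDyer.Theorems.AnalyticMuTwo

open scoped MatrixGroups ModularForm

open CongruenceSubgroup WeierstrassCurve Literature.NumberTheory.EllipticCurves
  Literature.NumberTheory.EllipticCurves.ModularForms Literature.NumberTheory.EllipticCurves.Rank1Residual
  Summit.BirchSwinnertonDyer.Rank1Residual.X5

section Socket3

variable (W : WeierstrassCurve ℚ) [W.IsElliptic] [W.IsGloballyMinimal]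

/-- **Per curve, surjective-image spelling**: good ordinary at `2` and `ρ̄_{E,2}` ONTO `GL₂(𝔽₂)` ⟹ for every newform
`f` of `W` some coefficient of `L₂(f, α, T)` is a `2`-adic unit (surjective ⟹ irreducible,
`hasIrreducibleModPGaloisRep_of_hasSurjectiveModNGaloisRep`; then `exists_norm_padicLCoeff_two_eq_one`).
[cite: GreenbergLNM1716, §1 Conj. 1.11 (posed for all p; the p = 2 analytic reading is ours)] -/
theorem exists_norm_coeff_padicLFunction_two_eq_one_of_surj (hgo : GoodOrd W 2)
    (hsurj : W.HasSurjectiveModNGaloisRep 2) {N : ℕ} [NeZero N] {f : CuspForm (Gamma0 N) 2}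
    (hf : IsNewformOf W f) :
    ∃ n : ℕ, ‖PowerSeries.coeff n (padicLFunction f (unitRoot W 2 : ℚ_[2]))‖ = 1 := by
  haveI : Fact (Nat.Prime 2) := ⟨Nat.prime_two⟩
  have hirr : W.HasIrreducibleModPGaloisRep 2 :=
    hasIrreducibleModPGaloisRep_of_hasSurjectiveModNGaloisRep W 2 (by exact_mod_cast hsurj)
  obtain ⟨k, hk⟩ := exists_norm_padicLCoeff_two_eq_one W hgo hirr hf
  exact ⟨k, by rw [coeff_padicLFunction]; exact hk⟩

/-- **SOCKET 3 of line `steinberg_fibre_at_two` (crux 19573), VERBATIM SHAPE, PROVED**: analytic `μ₂ = 0` in the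
`Ω⁺_f`-normalisation for every non-CM curve, good ordinary at `2`, `ρ̄_{E,2}` onto `S₃`, `ρ_{E,2^∞}` not onto, and every
newform `f` of it.  (`¬CM` and `¬ TwoAdicSurjective` are not used.)  The line's `AnalyticMuZeroFOnDD12Residue` is this
`Prop` by `Iff.rfl`. [cite: GreenbergLNM1716, §1 Conj. 1.11 (posed for all p; the p = 2 analytic reading is ours)] -/
theorem analyticMuZeroFOnDD12Residue_shape :
    ∀ (W : WeierstrassCurve ℚ) [W.IsElliptic] [W.IsGloballyMinimal],
      ¬ W.HasCM → GoodOrd W 2 → W.HasSurjectiveModNGaloisRep 2 → ¬ O1.TwoAdicSurjective W →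
      ∀ {N : ℕ} [NeZero N] (f : CuspForm (Gamma0 N) 2), IsNewformOf W f →
        ∃ n : ℕ, ‖PowerSeries.coeff n (padicLFunction f (unitRoot W 2 : ℚ_[2]))‖ = 1 :=
  fun W _ _ _ hgo hsurj _ _ _ _ hf ↦ exists_norm_coeff_padicLFunction_two_eq_one_of_surj W hgo hsurj hf

end Socket3

end Summit.BirchSwinnertonDyer.BirchSwinnertonDyer.Theorems.AnalyticMuTwo

end
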